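import Summits.BirchSwinnertonDyer.BirchSwinnertonDyer.Theorems.GenusKolyvaginAtTwoGenusPrimitiveSupplyAtTwoTwistUnramifiedGoodRow
import Literature.NumberTheory.EllipticCurves.Kramer1981.TwistedTateNormIndexProofs
import Literature.NumberTheory.DiophantineGeometry.TateAlgorithmRingEquivProofs
import Literature.NumberTheory.DiophantineGeometry.TateAlgorithmProofs
import HarnessLib

/-!
# Route `GenusKolyvaginAtTwo`, crux #2 `GenusPrimitiveSupplyAtTwo` (stmt-BirchSwinnertonDyer-22136):
# MAZUR–RUBIN LEMMA 2.10 (iii) AT EVERY FINITE PLACE, `v ∣ 2` INCLUDED — multiplicative reduction with `ord_v Δ` odd +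
# `K_v(√d)/K_v` unramified ⟹ the transported local Kummer conditions of `(E, E^{(d)})` AGREE (Kramer 1981 Props. 1, 2 (a))

Width seat `bsd-line-gk2-p5` g11 (cell `bsd-f1-sign2`, SUPPLY lineage), file 40 of the series (sequel of `…TwistUnramifiedGoodRow.lean`).
THEOREMS ONLY (no definition, no named fact, no `sorry`, no local instance); helper `--supports stmt-BirchSwinnertonDyer-22136`;
no item is closed; BSD is not proved by any of this.

WHAT. Mazur–Rubin 2010, Lemma 2.10 (iii): «if `E` has multiplicative reduction at `v`, `F/K` is unramified at `v`, and `ord_v(Δ_E)`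
is odd, then `H¹_f(K_v, E[2]) = H¹_f(K_v, E^F[2])`», proved in print from Lemma 2.9 and «[Kr, Propositions 1 and 2 (a)] shows that
`δ_v(E, F/K) = 0`». Both Kramer propositions are tree THEOREMS for an abstract `p`-adic field (`Kramer1981.props1_2a_multiplicativeNormIndex_holds`:
Prop. 1 — split multiplicative, `i(K/F) = 0 ⟺ (Δ, d)_F = −1`; Prop. 2 (a) — non-split multiplicative, `K/F` unramified, `i(K/F) = 0 ⟺ v(Δ)`
odd). For `v ∤ 2` the row is the lead's Tamagawa row; the new reach is `v ∣ 2` with `2` INERT in `K(√d)` — row (iii) at `p = 2` of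
`MazurRubin2010.d2_eq_of_lemma210_rat`. Assembly at `E = K_v`:

* §93 THE `𝒪_v`-DICTIONARY FOR MULTIPLICATIVE REDUCTION: `toSubring_adicCompletionIntegers_eq_valuationInteger`,
  `hasMultiplicativeReduction_minimal_valuationInteger` (the `𝒪[K_v]`-minimal model has multiplicative reduction),
  `kodairaSymbol_valuationInteger_eq_kodairaSymbolAt` (Tate's algorithm over `𝒪[K_v]` returns `W.kodairaSymbolAt v`, tree
  `kodairaSymbol_map_ringEquiv`), `kodairaSymbol_valuationInteger_eq_I` (type `I_n`, `n = ord_v Δ_min`);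
* §94 **`fixedSubgroup_le_normSubgroup_of_hasMultiplicativeReductionAt`** — `[E(K')^σ : N E(K')] = 1` for the unramified quadratic
  `K' = K_v(x)`, `x² = d`, when `ord_v Δ_min` is odd: non-split case = Kramer Prop. 2 (a) verbatim; split case = Kramer Prop. 1 with
  `(Δ_min, d)_{K_v} = −1` because an element of odd order is not a norm from the unramified quadratic extension
  (`Kramer1981.mem_quadraticNormSubgroup_iff_two_dvd_ord`, `Kramer1981.ord_Δ_eq_of_kodairaSymbol_eq_I`);
* §95 **`map_kummerLocalConditionAt_adicCompletion_eq_of_hasMultiplicativeReductionAt_of_mem_maxUnramified`** — LEMMA 2.10 (iii) for the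
  signed pair `(χ, θ)`, and **`exists_intertwining_hsplit_and_unramified`**: ONE identification `E^{(d)}[2] ≅ E[2]` with Lemma 2.10 (i),
  (v) [file 39] and (iii) at every finite place unramified in `K(√d)`, `v ∣ 2` allowed.

References: [MazurRubin2010] Lemma 2.9, Lemma 2.10 (iii) and its proof (arXiv:0904.3709 p. 7); [Kramer1981] §2 Props. 1, 2 (a) (p. 123),
Prop. 7; [SilvermanAEC2009] VII.1 Prop. 1.3, VII.5 Prop. 5.1; [SilvermanATAEC1994] IV.9.4 step 2; [SerreLocalFields1979] V §2.
-/

set_option linter.dupNamespace false -- tree convention: `Summit.BirchSwinnertonDyer.BirchSwinnertonDyer.Theorems` (summit = sub-problem)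
set_option autoImplicit false

noncomputable section

open scoped Classical ContRepresentation ValuativeRel

namespace Summit.BirchSwinnertonDyer.BirchSwinnertonDyer.Theorems.GenusKolyArch

open WeierstrassCurve Field NumberField IsDedekindDomain Function
open Literature.NumberTheory.EllipticCurves Literature.NumberTheory.GaloisRepresentations
open Literature.NumberTheory.GaloisRepresentations.IsNonarchimedeanLocalField (maxUnramified)
open Literature.NumberTheory.EllipticCurves.KramerTunnell1982 (normSubgroup fixedSubgroup)
open Literature.NumberTheory.DiophantineGeometry (KodairaSymbol)
open Literature.NumberTheory.QuadraticForms (hilbertSymbol quadraticNormSubgroup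
  hilbertSymbol_eq_neg_one_iff_not_mem_quadraticNormSubgroup)

/-! ## §93 The `𝒪_v`-dictionary for multiplicative reduction and the Kodaira symbol -/

section MultDict

variable {K : Type} [Field K] [NumberField K] (W : WeierstrassCurve K) [W.IsElliptic] (v : HeightOneSpectrum (𝓞 K))

omit W in
/-- `v.adicCompletionIntegers K` and `𝒪[K_v]` (valuation ring of the `ValuativeRel` structure) are the same subring of `K_v` (both
are the closed unit ball, `adicCompletion_valuation_le_one_iff`). [folklore] -/
theorem toSubring_adicCompletionIntegers_eq_valuationInteger :
    (v.adicCompletionIntegers K).toSubring = (ValuativeRel.valuation (v.adicCompletion K)).integer := by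
  ext x
  change x ∈ v.adicCompletionIntegers K ↔ _
  rw [HeightOneSpectrum.mem_adicCompletionIntegers, ← Valued.toNormedField.norm_le_one_iff,
    ← adicCompletion_valuation_le_one_iff K v x, Valuation.mem_integer_iff]

/-- **Multiplicative reduction at `v` ⟹ the `𝒪[K_v]`-minimal model of `W ⊗ K_v` has multiplicative reduction** (transport from
`v.adicCompletionIntegers K` to `𝒪[K_v]` along the identity of `K_v`, `hasMultiplicativeReduction_map_iff`, then independence
of the minimal equation for `Δ ≠ 0`, `hasMultiplicativeReduction_iff_of_isMinimal_of_eq_smul`).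
[cite: SilvermanAEC2009, VII.5 Prop. 5.1 (b) and VII.1 Prop. 1.3 (b)] -/
theorem hasMultiplicativeReduction_minimal_valuationInteger (hv : W.HasMultiplicativeReductionAt v) :
    ((W.baseChange (v.adicCompletion K)).minimal 𝒪[v.adicCompletion K]).HasMultiplicativeReduction 𝒪[v.adicCompletion K] := by
  obtain ⟨C, hC⟩ : ∃ C : VariableChange (v.adicCompletion K),
      W.localMinimalModel v = C • W.baseChange (v.adicCompletion K) := ⟨_, rfl⟩
  obtain ⟨D, hD⟩ : ∃ D : VariableChange (v.adicCompletion K),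
      (W.baseChange (v.adicCompletion K)).minimal 𝒪[v.adicCompletion K] = D • W.baseChange (v.adicCompletion K) := ⟨_, rfl⟩
  have he := mem_range_algebraMap_valuationInteger_iff (K := K) v
  have hmult : ((W.localMinimalModel v).map
      ((RingEquiv.refl (v.adicCompletion K)) : v.adicCompletion K →+* v.adicCompletion K)).HasMultiplicativeReduction
        𝒪[v.adicCompletion K] :=
    (hasMultiplicativeReduction_map_iff (RingEquiv.refl (v.adicCompletion K)) he (W.localMinimalModel v)).mpr hv
  rw [RingEquiv.coe_ringHom_refl, WeierstrassCurve.map_id] at hmult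
  haveI : (W.localMinimalModel v).IsMinimal 𝒪[v.adicCompletion K] := hmult.toIsMinimal
  have hrel : (W.baseChange (v.adicCompletion K)).minimal 𝒪[v.adicCompletion K] = (D * C⁻¹) • W.localMinimalModel v := by
    rw [hD, hC, smul_smul, inv_mul_cancel_right]
  have hΔ : (W.localMinimalModel v).Δ ≠ 0 := by
    rw [hC, variableChange_Δ]
    exact mul_ne_zero (pow_ne_zero _ (Units.ne_zero _)) (W.baseChange (v.adicCompletion K)).isUnit_Δ.ne_zero
  exact (hasMultiplicativeReduction_iff_of_isMinimal_of_eq_smul 𝒪[v.adicCompletion K] hrel hΔ).mpr hmult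

/-- **Tate's algorithm over `𝒪[K_v]` returns `W.kodairaSymbolAt v`** (the Kodaira symbol is intrinsic to the valued field: tree
`kodairaSymbol_map_ringEquiv` along the identity of `K_v` and the identification `v.adicCompletionIntegers K ≃+* 𝒪[K_v]` of
§93; both residue fields are finite, hence perfect). [cite: SilvermanATAEC1994, IV.9.4 and Rem. IV.9.5] -/
theorem kodairaSymbol_valuationInteger_eq_kodairaSymbolAt :
    (W.baseChange (v.adicCompletion K)).kodairaSymbol 𝒪[v.adicCompletion K] = W.kodairaSymbolAt v := by
  set ψ : (v.adicCompletionIntegers K) ≃+* 𝒪[v.adicCompletion K] :=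
    RingEquiv.subringCongr (toSubring_adicCompletionIntegers_eq_valuationInteger (K := K) v) with hψ
  have hc : ∀ r : v.adicCompletionIntegers K, (RingEquiv.refl (v.adicCompletion K))
      (algebraMap (v.adicCompletionIntegers K) (v.adicCompletion K) r) =
        algebraMap 𝒪[v.adicCompletion K] (v.adicCompletion K) (ψ r) := fun _ ↦ rfl
  have h := kodairaSymbol_map_ringEquiv ψ (RingEquiv.refl (v.adicCompletion K)) hc (W.baseChange (v.adicCompletion K))
    (W.baseChange (v.adicCompletion K)).isUnit_Δ.ne_zero
  rw [RingEquiv.coe_ringHom_refl, WeierstrassCurve.map_id] at h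
  exact h

/-- **Multiplicative reduction at `v` has Kodaira type `I_n` with `n = ord_v Δ_min`** over `𝒪[K_v]` (tree `kodairaSymbolAt_eq_I_iff_holds`,
Tate's algorithm step 2, through §93's identification), here for `n = W.ordMinimalDiscriminant v ≠ 0`.
[cite: SilvermanATAEC1994, IV.9.4 step 2] [cite: SilvermanAEC2009, VII.5 Prop. 5.1 (b)] -/
theorem kodairaSymbol_valuationInteger_eq_I (hv : W.HasMultiplicativeReductionAt v) (hn : W.ordMinimalDiscriminant v ≠ 0) :
    (W.baseChange (v.adicCompletion K)).kodairaSymbol 𝒪[v.adicCompletion K] = .I (W.ordMinimalDiscriminant v) := by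
  rw [kodairaSymbol_valuationInteger_eq_kodairaSymbolAt W v]
  exact (WeierstrassCurve.kodairaSymbolAt_eq_I_iff_holds v W hn).mpr ⟨hv, rfl⟩

end MultDict

/-! ## §94 Kramer Props. 1 and 2 (a): `[E(K')^σ : N E(K')] = 1` for multiplicative reduction with `ord_v Δ_min` odd -/

section MultNorm

variable {K : Type} [Field K] [NumberField K] (W : WeierstrassCurve K) [W.IsElliptic] (v : HeightOneSpectrum (𝓞 K))

/-- **Kramer 1981 Props. 1, 2 (a) at a place of MULTIPLICATIVE reduction with `ord_v Δ_min` ODD, in the point currency of `W ⊗ K_v`:**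
for the unramified quadratic `K' = K_v(x) ⊆ K̄_v` (`x² = d`, `d ∉ K_v²`, `K' ≤ maxUnramified`, `[K' : K_v] = 2`, `σ ≠ 1`), every
`σ`-fixed `K'`-point of `W` is a norm `Q + σQ`. Non-split multiplicative: Prop. 2 (a) with the Kodaira type `I_n`, `n = ord_v Δ_min` odd
(§93). Split multiplicative (Tate curve): Prop. 1, the Hilbert symbol `(Δ_min, d)_{K_v}` being `−1` since `Δ_min` has odd order
(`Kramer1981.ord_Δ_eq_of_kodairaSymbol_eq_I`) and the norms from the unramified `K'` are exactly the elements of even order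
(`Kramer1981.mem_quadraticNormSubgroup_iff_two_dvd_ord`). This is «`δ_v(E, F/K) = 0`» of the printed proof of Lemma 2.10 (iii).
[cite: Kramer1981, §2 Props. 1 and 2 (a) (p. 123)] [cite: MazurRubin2010, proof of Lemma 2.10 (iii)] -/
theorem fixedSubgroup_le_normSubgroup_of_hasMultiplicativeReductionAt (hv : W.HasMultiplicativeReductionAt v)
    (hodd : Odd (W.ordMinimalDiscriminant v))
    {K' : IntermediateField (v.adicCompletion K) (AlgebraicClosure (v.adicCompletion K))}
    (hK' : K' ≤ maxUnramified (v.adicCompletion K)) (h2 : Module.finrank (v.adicCompletion K) K' = 2)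
    {σ : K' ≃ₐ[v.adicCompletion K] K'} (hσ : σ ≠ 1) {dv : v.adicCompletion K} (hd : ¬ IsSquare dv) {x : K'}
    (hx : x ^ 2 = algebraMap (v.adicCompletion K) K' dv) :
    fixedSubgroup (W.baseChange (v.adicCompletion K)) K' σ ≤ normSubgroup (W.baseChange (v.adicCompletion K)) K' σ := by
  haveI : CharZero (v.adicCompletion K) := charZero_of_injective_algebraMap (algebraMap K _).injective
  have hn0 : W.ordMinimalDiscriminant v ≠ 0 := fun h ↦ by simp [h] at hodd
  have hmult := hasMultiplicativeReduction_minimal_valuationInteger W v hv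
  have hkod := kodairaSymbol_valuationInteger_eq_I W v hv hn0
  obtain ⟨h1, h2a⟩ := Kramer1981.props1_2a_multiplicativeNormIndex_holds (v.adicCompletion K)
    (W.baseChange (v.adicCompletion K)) K' h2 σ hσ dv hd x hx
  refine AddSubgroup.relIndex_eq_one.mp ?_
  by_cases hsplit : ((W.baseChange (v.adicCompletion K)).minimal 𝒪[v.adicCompletion K]).HasSplitMultiplicativeReduction
    𝒪[v.adicCompletion K]
  · -- Kramer Prop. 1: `(Δ_min, d) = −1` since `ord Δ_min` is odd and `K'` is unramified
    refine (h1 hsplit).1 ?_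
    obtain ⟨-, hord⟩ := Kramer1981.ord_Δ_eq_of_kodairaSymbol_eq_I (W.baseChange (v.adicCompletion K)) hmult hkod
    haveI : ((W.baseChange (v.adicCompletion K)).minimal 𝒪[v.adicCompletion K]).IsElliptic := by
      change (((W.baseChange (v.adicCompletion K)).exists_isMinimal 𝒪[v.adicCompletion K]).choose •
        W.baseChange (v.adicCompletion K)).IsElliptic
      infer_instance
    have hΔ0 : ((W.baseChange (v.adicCompletion K)).minimal 𝒪[v.adicCompletion K]).Δ ≠ 0 :=
      ((W.baseChange (v.adicCompletion K)).minimal 𝒪[v.adicCompletion K]).isUnit_Δ.ne_zero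
    have hd0 : dv ≠ 0 := fun h ↦ hd ⟨0, by rw [h, mul_zero]⟩
    have hnot : Units.mk0 _ hΔ0 ∉ quadraticNormSubgroup (v.adicCompletion K) dv := by
      rw [Kramer1981.mem_quadraticNormSubgroup_iff_two_dvd_ord hK' h2 hd hx hσ, Units.val_mk0, hord]
      intro h2dvd
      obtain ⟨m, hm⟩ := hodd
      omega
    have h := (hilbertSymbol_eq_neg_one_iff_not_mem_quadraticNormSubgroup hd0 (Units.mk0 _ hΔ0)).mpr hnot
    rwa [Units.val_mk0] at h
  · -- Kramer Prop. 2 (a): twisted Tate curve, `K'/K_v` unramified, `I_n` with `n` odd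
    exact (h2a hmult hsplit hK' _ hkod).1 hodd

end MultNorm

/-! ## §95 Lemma 2.10 (iii) + (v) at every finite place unramified in `K(√d)`: `hnorm`, the row, the packaged form -/

section Row

variable {K : Type} [Field K] [NumberField K] (W : WeierstrassCurve K) [W.IsElliptic] (v : HeightOneSpectrum (𝓞 K)) {d : K}

/-- **THE ENGINE'S `hnorm` AT A SEMISTABLE PLACE UNRAMIFIED IN `K(√d)`**: `W` good at `v`, or multiplicative at `v` with `ord_v Δ_min`
odd; `ι√d ∈ K_v^{nr}`, `d ∉ K_v²`, `τ₀ ∈ Γ_{K_v}` flipping `ι√d` ⟹ every `Γ_{K_v}`-fixed point of `W(K̄_v)` is `Q + τ₀Q` with `Q`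
fixed by the index-`2` subgroup fixing `ι√d` («`E_N(K_v) = E(K_v)`»: §89 / §94 + file 37, with `σ = τ₀|_{K_v(ι√d)}`).
[cite: MazurRubin2010, proof of Lemma 2.10 (iii), (v)] [cite: Kramer1981, §2 Props. 1 and 2 (a) (p. 123)] -/
theorem forall_exists_norm_of_semistable_of_mem_maxUnramified
    (hv : W.HasGoodReductionAt v ∨ (W.HasMultiplicativeReductionAt v ∧ Odd (W.ordMinimalDiscriminant v)))
    (hα : closureEmb (K := K) (v.adicCompletion K) (geomSqrt d) ∈ maxUnramified (v.adicCompletion K))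
    (hd : ∀ s : v.adicCompletion K, s ^ 2 ≠ algebraMap K (v.adicCompletion K) d)
    {τ₀ : absoluteGaloisGroup (v.adicCompletion K)}
    (hτ₀ : (show AlgebraicClosure (v.adicCompletion K) ≃ₐ[v.adicCompletion K] AlgebraicClosure (v.adicCompletion K) from τ₀)
        (closureEmb (K := K) (v.adicCompletion K) (geomSqrt d)) = -closureEmb (K := K) (v.adicCompletion K) (geomSqrt d)) :
    ∀ P ∈ MulAction.fixedPoints (absoluteGaloisGroup (v.adicCompletion K)) (localPoints W (v.adicCompletion K)),
      ∃ Q : localPoints W (v.adicCompletion K),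
        (∀ g : absoluteGaloisGroup (v.adicCompletion K),
          (show AlgebraicClosure (v.adicCompletion K) ≃ₐ[v.adicCompletion K] AlgebraicClosure (v.adicCompletion K) from g)
              (closureEmb (K := K) (v.adicCompletion K) (geomSqrt d)) =
              closureEmb (K := K) (v.adicCompletion K) (geomSqrt d) →
            g • Q = Q) ∧ Q + τ₀ • Q = P := by
  haveI : CharZero (v.adicCompletion K) := charZero_of_injective_algebraMap (algebraMap K _).injective
  have hint := isIntegral_closureEmb_geomSqrt (K := K) (d := d) (v.adicCompletion K)
  have h2 := finrank_adjoin_closureEmb_geomSqrt_eq_two v hd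
  haveI : Algebra.IsQuadraticExtension (v.adicCompletion K)
      (IntermediateField.adjoin (v.adicCompletion K) {closureEmb (K := K) (v.adicCompletion K) (geomSqrt d)}) :=
    { finrank_eq_two' := h2 }
  -- `σ := τ₀|_{K'}`
  set σ := (show AlgebraicClosure (v.adicCompletion K) ≃ₐ[v.adicCompletion K] AlgebraicClosure (v.adicCompletion K)
    from τ₀).restrictNormal
      (IntermediateField.adjoin (v.adicCompletion K) {closureEmb (K := K) (v.adicCompletion K) (geomSqrt d)}) with hσdef
  have hσ : ((σ (IntermediateField.AdjoinSimple.gen (v.adicCompletion K)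
      (closureEmb (K := K) (v.adicCompletion K) (geomSqrt d))) :
        IntermediateField.adjoin (v.adicCompletion K) {closureEmb (K := K) (v.adicCompletion K) (geomSqrt d)}) :
          AlgebraicClosure (v.adicCompletion K)) = -closureEmb (K := K) (v.adicCompletion K) (geomSqrt d) := by
    have h := AlgEquiv.restrictNormal_commutes
      (show AlgebraicClosure (v.adicCompletion K) ≃ₐ[v.adicCompletion K] AlgebraicClosure (v.adicCompletion K) from τ₀)
      (IntermediateField.adjoin (v.adicCompletion K) {closureEmb (K := K) (v.adicCompletion K) (geomSqrt d)})
      (IntermediateField.AdjoinSimple.gen (v.adicCompletion K) (closureEmb (K := K) (v.adicCompletion K) (geomSqrt d)))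
    rw [← hσdef] at h
    change ((σ _ : IntermediateField.adjoin (v.adicCompletion K) {closureEmb (K := K) (v.adicCompletion K) (geomSqrt d)}) :
      AlgebraicClosure (v.adicCompletion K)) = (show AlgebraicClosure (v.adicCompletion K) ≃ₐ[v.adicCompletion K]
        AlgebraicClosure (v.adicCompletion K) from τ₀) (closureEmb (K := K) (v.adicCompletion K) (geomSqrt d)) at h
    rw [h, hτ₀]
  have hα0 : closureEmb (K := K) (v.adicCompletion K) (geomSqrt d) ≠ 0 := by
    intro h0
    apply hd 0
    have h := closureEmb_geomSqrt_sq_eq_algebraMap (K := K) (d := d) v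
    rw [h0, zero_pow two_ne_zero, eq_comm, map_eq_zero] at h
    rw [h, zero_pow two_ne_zero]
  have hσ1 : σ ≠ 1 := by
    intro h1
    rw [h1, AlgEquiv.one_apply, IntermediateField.AdjoinSimple.coe_gen, eq_neg_iff_add_eq_zero, ← two_mul,
      mul_eq_zero] at hσ
    exact hσ.elim (fun h ↦ two_ne_zero h) hα0
  have hK' := adjoin_closureEmb_geomSqrt_le_maxUnramified (K := K) (d := d) v hα
  have hle : fixedSubgroup (W.baseChange (v.adicCompletion K))
      (IntermediateField.adjoin (v.adicCompletion K) {closureEmb (K := K) (v.adicCompletion K) (geomSqrt d)}) σ ≤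
      normSubgroup (W.baseChange (v.adicCompletion K))
        (IntermediateField.adjoin (v.adicCompletion K) {closureEmb (K := K) (v.adicCompletion K) (geomSqrt d)}) σ := by
    rcases hv with hgood | ⟨hmult, hodd⟩
    · exact fixedSubgroup_le_normSubgroup_of_hasGoodReductionAt W v hgood hK' h2 hσ1
    · have hdsq : ¬ IsSquare (algebraMap K (v.adicCompletion K) d) := by
        rintro ⟨r, hr⟩
        exact hd r (by rw [hr, sq])
      exact fixedSubgroup_le_normSubgroup_of_hasMultiplicativeReductionAt W v hmult hodd hK' h2 hσ1 hdsq
        (adjoinSimple_gen_sq (K := K) (d := d) v)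
  exact forall_exists_norm_of_fixedSubgroup_le_normSubgroup W (v.adicCompletion K) σ hσ hle hτ₀

variable {Wd : WeierstrassCurve K} [Wd.IsElliptic]
  (χ : (Wd.torsionGaloisModule ((2 : ℕ) : ℤ)).toContRepresentation →ⁱL
    (W.torsionGaloisModule ((2 : ℕ) : ℤ)).toContRepresentation)
  (ψ : (W.torsionGaloisModule ((2 : ℕ) : ℤ)).toContRepresentation →ⁱL
    (Wd.torsionGaloisModule ((2 : ℕ) : ℤ)).toContRepresentation)
  (hψχ : ∀ a, ψ (χ a) = a) (hχψ : ∀ b, χ (ψ b) = b)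

include hψχ hχψ in
/-- **MAZUR–RUBIN LEMMA 2.10 (iii) and (v) at a finite place `v` of a number field, `v ∣ 2` INCLUDED.** For the signed pair `(χ, θ)`
of file 6: IF `W` is good at `v`, or multiplicative at `v` with `ord_v Δ_min` odd, AND `ι√d ∈ K_v^{nr}` (`v` unramified in `K(√d)`),
`d ∉ K_v²`, THEN `φ_* 𝓛_v(Wd) = 𝓛_v(W)`. [cite: MazurRubin2010, Lemma 2.10 (iii), (v) and their proofs (arXiv:0904.3709 p. 7)]
[cite: Kramer1981, §2 Props. 1 and 2 (a) (p. 123)] [cite: KramerTunnell1982, §6 Lemma 6.1 (p. 327), type I₀] -/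
theorem map_kummerLocalConditionAt_adicCompletion_eq_of_semistable_of_mem_maxUnramified
    (θ : localPoints Wd (v.adicCompletion K) ≃+ localPoints W (v.adicCompletion K))
    (hfix : ∀ σ : absoluteGaloisGroup (v.adicCompletion K),
      (show AlgebraicClosure (v.adicCompletion K) ≃ₐ[v.adicCompletion K] AlgebraicClosure (v.adicCompletion K) from σ)
          (closureEmb (K := K) (v.adicCompletion K) (geomSqrt d)) = closureEmb (K := K) (v.adicCompletion K) (geomSqrt d) →
        ∀ P : localPoints Wd (v.adicCompletion K), θ (σ • P) = σ • θ P)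
    (hneg : ∀ σ : absoluteGaloisGroup (v.adicCompletion K),
      (show AlgebraicClosure (v.adicCompletion K) ≃ₐ[v.adicCompletion K] AlgebraicClosure (v.adicCompletion K) from σ)
          (closureEmb (K := K) (v.adicCompletion K) (geomSqrt d)) = -closureEmb (K := K) (v.adicCompletion K) (geomSqrt d) →
        ∀ P : localPoints Wd (v.adicCompletion K), θ (σ • P) = -(σ • θ P))
    (hdich : ∀ σ : absoluteGaloisGroup (v.adicCompletion K),
      (show AlgebraicClosure (v.adicCompletion K) ≃ₐ[v.adicCompletion K] AlgebraicClosure (v.adicCompletion K) from σ)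
          (closureEmb (K := K) (v.adicCompletion K) (geomSqrt d)) = closureEmb (K := K) (v.adicCompletion K) (geomSqrt d) ∨
        (show AlgebraicClosure (v.adicCompletion K) ≃ₐ[v.adicCompletion K] AlgebraicClosure (v.adicCompletion K) from σ)
          (closureEmb (K := K) (v.adicCompletion K) (geomSqrt d)) = -closureEmb (K := K) (v.adicCompletion K) (geomSqrt d))
    (hχ : ∀ t : geomTorsion Wd ((2 : ℕ) : ℤ),
      pointsMap W (v.adicCompletion K) (χ t : geomPoints W) = θ (pointsMap Wd (v.adicCompletion K) (t : geomPoints Wd)))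
    (hv : W.HasGoodReductionAt v ∨ (W.HasMultiplicativeReductionAt v ∧ Odd (W.ordMinimalDiscriminant v)))
    (hα : closureEmb (K := K) (v.adicCompletion K) (geomSqrt d) ∈ maxUnramified (v.adicCompletion K))
    (hd : ∀ s : v.adicCompletion K, s ^ 2 ≠ algebraMap K (v.adicCompletion K) d) :
    (Wd.kummerLocalConditionAt ((2 : ℕ) : ℤ) (v.adicCompletion K)).map
        (galoisCohomology.map (χ.restrictField (v.adicCompletion K)) 1) =
      W.kummerLocalConditionAt ((2 : ℕ) : ℤ) (v.adicCompletion K) := by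
  obtain ⟨τ₀, hτ₀⟩ := exists_flip_closureEmb_geomSqrt (K := K) (d := d) v hd
  exact map_kummerLocalConditionAt_adicCompletion_eq_of_forall_exists_norm W χ ψ hψχ hχψ v θ hfix hneg hdich hχ hτ₀
    (forall_exists_norm_of_semistable_of_mem_maxUnramified W v hv hα hd hτ₀)

end Row

section Packaged

variable {K : Type} [Field K] [NumberField K] (W Wd : WeierstrassCurve K) [W.IsElliptic] [Wd.IsElliptic]

/-- **Lemma 2.10 (i), (iii), (v) (dyadic places included) for ONE identification `E^{(d)}[2] ≅ E[2]`.** For `W/K` elliptic over a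
number field, `d ≠ 0`, `Wd = C • W^{(d)}` elliptic: inverse intertwinings `φ, φ'` with the split-place agreement AND, at every finite
place `v` UNRAMIFIED in `K(√d)` (`ι√d ∈ K_v^{nr}`; `v ∣ 2` allowed) where `W` is good, or multiplicative with `ord_v Δ_min` odd,
`φ_* 𝓛_v(Wd) = 𝓛_v(W)` (the sub-case `d ∈ K_v²` by (i)). Input shape of the place menus.
[cite: MazurRubin2010, Lemma 2.10 (i), (iii), (v)] [cite: Kramer1981, §2 Props. 1 and 2 (a)] [cite: KramerTunnell1982, §6 Lemma 6.1, type I₀] -/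
theorem exists_intertwining_hsplit_and_unramified {d : K} (hd : d ≠ 0) {C : VariableChange K}
    (hWd : C • W.quadraticTwist d = Wd) :
    ∃ (φ : (Wd.torsionGaloisModule ((2 : ℕ) : ℤ)).toContRepresentation →ⁱL
        (W.torsionGaloisModule ((2 : ℕ) : ℤ)).toContRepresentation)
      (φ' : (W.torsionGaloisModule ((2 : ℕ) : ℤ)).toContRepresentation →ⁱL
        (Wd.torsionGaloisModule ((2 : ℕ) : ℤ)).toContRepresentation),
      (∀ a, φ' (φ a) = a) ∧ (∀ b, φ (φ' b) = b) ∧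
      (∀ (E : Type) [Field E] [Algebra K E], (∃ s : E, s ^ 2 = algebraMap K E d) →
        (Wd.kummerLocalConditionAt ((2 : ℕ) : ℤ) E).map (galoisCohomology.map (φ.restrictField E) 1) =
          W.kummerLocalConditionAt ((2 : ℕ) : ℤ) E) ∧
      ∀ (v : HeightOneSpectrum (𝓞 K)),
        (W.HasGoodReductionAt v ∨ (W.HasMultiplicativeReductionAt v ∧ Odd (W.ordMinimalDiscriminant v))) →
        closureEmb (K := K) (v.adicCompletion K) (geomSqrt d) ∈ maxUnramified (v.adicCompletion K) →
        (Wd.kummerLocalConditionAt ((2 : ℕ) : ℤ) (v.adicCompletion K)).map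
            (galoisCohomology.map (φ.restrictField (v.adicCompletion K)) 1) =
          W.kummerLocalConditionAt ((2 : ℕ) : ℤ) (v.adicCompletion K) := by
  obtain ⟨φ, φ', hφ'φ, hφφ', hsplit, hloc⟩ := exists_intertwining_hsplit_and_signed W Wd hd hWd
  refine ⟨φ, φ', hφ'φ, hφφ', hsplit, fun v hv hα ↦ ?_⟩
  by_cases hsq : ∃ s : v.adicCompletion K, s ^ 2 = algebraMap K (v.adicCompletion K) d
  · exact hsplit (v.adicCompletion K) hsq
  · obtain ⟨θ, hfix, hneg, hdich, hχ⟩ := hloc (v.adicCompletion K)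
    exact map_kummerLocalConditionAt_adicCompletion_eq_of_semistable_of_mem_maxUnramified W v φ φ' hφ'φ hφφ' θ
      hfix hneg hdich hχ hv hα (fun s hs ↦ hsq ⟨s, hs⟩)

end Packaged

end Summit.BirchSwinnertonDyer.BirchSwinnertonDyer.Theorems.GenusKolyArch

end
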